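import Mathlib
import Literature.NumberTheory.Automorphic.ClozelAlgebraicity
import Literature.NumberTheory.Automorphic.ClozelAlgebraicitySplit
import Literature.NumberTheory.Automorphic.ClozelAlgebraicityRatFieldProofs
import Literature.NumberTheory.Automorphic.AutomorphicRepsGLSatakeFlathProofs
import Summits.Langlands.Langlands.Theorems.IrreducibilityBySelfDualityHeckeEigenvalueFieldStubS3
import Summits.Langlands.Langlands.Theorems.IrreducibilityBySelfDualityHeckeEigenvalueFieldBaireUnif
import HarnessLib

/-!
# Crux `HeckeEigenvalueField` (stmt-Langlands-13632), line `BaireSketch` — the composition: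
# (S3) + UNIF + (S4) + clause (ii) of Clozel's theorem ⟹ the Hecke field

Supports file for the crux `Summit.Langlands.Langlands.Theses.IrreducibilityBySelfDuality.HeckeEigenvalueField`
(= `Literature.NumberTheory.Automorphic.Clozel1990_heckeEigenvalueField`, `Iff.rfl`; Clozel 1990,
Thm. 3.13 in Hecke-eigenvalue form: the unramified Hecke eigenvalues of a regular algebraic cuspidal `π`
on `GL_n(𝔸_K)` at almost all places lie in one number field).

* `heckeEigenvalueField_of_S3_S4_conj` — the kernel-checked reduction of the line: (S3) one
  automorphism of `ℂ` moves the transcendental entries of a countable family off a countable subfield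
  + (S4) countably many cofinite germs of unramified Hecke eigensystems of regular algebraic cuspidal `π`
  + (ii) existence of regular algebraic cuspidal `Aut(ℂ)`-conjugates at almost all places ⟹ the Hecke
  field.  Mechanism: Satake uniqueness (`hasSatakeParamAt_unique_holds`) turns `IsAutConjugate σ π π'`
  into "`σ ∘` eigensystem(`π`) agrees a.e. with eigensystem(`π'`)", so by (S4) the `Aut(ℂ)`-orbit of
  the eigensystem GERM of `π` is countable; Baire category on the compact group `Gal(ℚ̄/ℚ)`
  (`uniform_of_countable_autOrbit`, landed in `…BaireUnif.lean`, fed by `stub_S3`, landed in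
  `…StubS3.lean`) then produces ONE number field containing all but finitely many eigenvalues — the
  σ-dependent exceptional finite sets of `IsAutConjugate` are uniformized, which is exactly the step the
  docstring of `Clozel1990_heckeEigenvalueField` records as missing ("no uniform cofinite set of places
  follows").
* `clozel1990_heckeEigenvalueField_of_S4_autConjugates` — the same with (S3) discharged by the landed
  `stub_S3`: (S4) + clause (ii) ⟹ the Hecke field ((S4) is proved in `…S4.lean`; the final unconditional-
  in-(S4) closures live in `…BaireFinal.lean`).
* `autConjugates_of_exists_autConjugate` / `autConjugates_of_clozel1990` — clause (ii) in the form used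
  here follows from the named fact `Clozel1990_exists_autConjugate` (clause (ii) of Thm. 3.13 alone,
  `ClozelAlgebraicitySplit.lean`), resp. from the four-clause `Clozel1990_regularAlgebraic`.

References: L. Clozel, *Motifs et formes automorphes: applications du principe de fonctorialité*,
Ann Arbor 1988 (Academic Press 1990), Thm. 3.13, §3.5 [Clozel1990]; S. Patrikis, *Variations on a
theorem of Tate*, Mem. AMS 258 (2019), Thm. 3.2.1 [Patrikis2019].
-/

set_option linter.dupNamespace false -- project-wide: `Summit.Langlands.Langlands` is the mandated namespace

noncomputable section

open scoped Classical
open Filter NumberField IsDedekindDomain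
open Literature.NumberTheory.Automorphic

namespace Summit.Langlands.Langlands.Theorems.HeckeEigenvalueField.Baire

/-! ## Clause (ii) in the form used by the line -/

open Literature.NumberTheory.Automorphic in
/-- Clause (ii) in the form of the stub follows from the named fact `Clozel1990_exists_autConjugate`
(clause (ii) of Clozel's Thm. 3.13 alone): the conjugate `π'` it provides has an infinity type with
the `a`-multisets of `^σT`, hence is regular algebraic
(`InfinityType.isRegularAlgebraic_of_map_a_eq_autConj`). [cite: Clozel1990, Thm. 3.13] -/
theorem autConjugates_of_exists_autConjugate (h : Clozel1990_exists_autConjugate) :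
    ∀ (n : ℕ) (K : Type) [Field K] [NumberField K]
    (hcpt : isCompact_glFiniteIntegralLevel n K)
    (π : CuspidalAutomorphicRepData n K hcpt), π.1.IsRegularAlgebraic → ∀ σ : ℂ ≃ₐ[ℚ] ℂ,
      ∃ π' : CuspidalAutomorphicRepData n K hcpt, IsAutConjugate σ π.1 π'.1 ∧ π'.1.IsRegularAlgebraic := by
  intro n K _ _ hcpt π hπ σ
  obtain ⟨T, hT, hreg⟩ := hπ
  obtain ⟨π', hc, hT'⟩ := h n K hcpt π ⟨T, hT, hreg⟩ σ
  obtain ⟨T', hT'π, ha⟩ := hT' T hT hreg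
  exact ⟨π', hc, T', hT'π, InfinityType.isRegularAlgebraic_of_map_a_eq_autConj hreg hT'π.1 σ ha⟩

open Literature.NumberTheory.Automorphic in
/-- Clause (ii) follows from the vendored four-clause fact `Clozel1990_regularAlgebraic`
(`Clozel1990_regularAlgebraic.exists_isAutConjugate_isRegularAlgebraic`, proved in tree).
[cite: Clozel1990, Thm. 3.13] -/
theorem autConjugates_of_clozel1990 (h : Clozel1990_regularAlgebraic) :
    ∀ (n : ℕ) (K : Type) [Field K] [NumberField K]
    (hcpt : isCompact_glFiniteIntegralLevel n K)
    (π : CuspidalAutomorphicRepData n K hcpt), π.1.IsRegularAlgebraic → ∀ σ : ℂ ≃ₐ[ℚ] ℂ,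
      ∃ π' : CuspidalAutomorphicRepData n K hcpt, IsAutConjugate σ π.1 π'.1 ∧ π'.1.IsRegularAlgebraic :=
  fun _ _ _ _ _ π hπ σ => h.exists_isAutConjugate_isRegularAlgebraic π hπ σ

/-! ## The composition: (UNIF from S3) + S4 + (ii) ⟹ the crux -/

section Automorphic

open Literature.NumberTheory.Automorphic NumberField IsDedekindDomain

/-- **The reduction, kernel-checked**: (S3) + (S4) + clause (ii) ⟹ the crux (stated as the
definitionally equal named fact `Clozel1990_heckeEigenvalueField`). Satake
uniqueness (`hasSatakeParamAt_unique_holds`) turns `IsAutConjugate` into "σ ∘ eigensystem(π) agrees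
a.e. with eigensystem(π')", S4 makes the orbit of the germ countable, UNIF gives the number field.
[folklore] -/
theorem heckeEigenvalueField_of_S3_S4_conj
    (hS3 : ∀ (M : Subfield ℂ), Cardinal.mk M ≤ Cardinal.aleph0 →
      ∀ (ι : Type) [Countable ι] (a : ι → ℂ),
        ∃ σ : ℂ ≃ₐ[ℚ] ℂ, ∀ v, Transcendental ℚ (a v) → σ (a v) ∉ M)
    (hS4 : ∀ (n : ℕ) (K : Type) [Field K] [NumberField K]
      (hcpt : isCompact_glFiniteIntegralLevel n K),
      ∃ 𝒞 : Set (HeightOneSpectrum (𝓞 K) × Fin (n + 1) → ℂ), 𝒞.Countable ∧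
        ∀ π : CuspidalAutomorphicRepData n K hcpt, π.1.IsRegularAlgebraic →
          ∃ c ∈ 𝒞, ∀ᶠ v in cofinite, ∀ α : Multiset ℂ, π.1.HasSatakeParamAt v α →
            ∀ i : Fin (n + 1), heckeEigenvalueOf n v α i = c (v, i))
    (hA : ∀ (n : ℕ) (K : Type) [Field K] [NumberField K]
      (hcpt : isCompact_glFiniteIntegralLevel n K)
      (π : CuspidalAutomorphicRepData n K hcpt), π.1.IsRegularAlgebraic → ∀ σ : ℂ ≃ₐ[ℚ] ℂ,
        ∃ π' : CuspidalAutomorphicRepData n K hcpt, IsAutConjugate σ π.1 π'.1 ∧ π'.1.IsRegularAlgebraic) :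
    Clozel1990_heckeEigenvalueField := by
  intro n K _ _ hcpt π hπ
  classical
  haveI : Countable (HeightOneSpectrum (𝓞 K)) := countable_heightOneSpectrum K
  obtain ⟨𝒞, h𝒞, h𝒞π⟩ := hS4 n K hcpt
  -- the eigensystem of `π` as a genuine function (`0` where ramified)
  let a : HeightOneSpectrum (𝓞 K) × Fin (n + 1) → ℂ := fun p =>
    if h : π.1.IsUnramifiedAt p.1 then heckeEigenvalueOf n p.1 (Classical.choose h) p.2 else 0
  have ha : ∀ {v : HeightOneSpectrum (𝓞 K)} {α : Multiset ℂ} (_ : π.1.HasSatakeParamAt v α)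
      (i : Fin (n + 1)), a (v, i) = heckeEigenvalueOf n v α i := by
    intro v α hα i
    have h : π.1.IsUnramifiedAt v := ⟨α, hα⟩
    show (if h : π.1.IsUnramifiedAt v then heckeEigenvalueOf n v (Classical.choose h) i else 0) = _
    rw [dif_pos h]
    congr 1
    exact AutomorphicRepData.hasSatakeParamAt_unique_holds π.1 (Classical.choose_spec h) hα
  -- clause (ii) + Satake uniqueness + S4: the orbit of `a` lies in `𝒞` modulo finite sets
  have horbit : ∀ σ : ℂ ≃ₐ[ℚ] ℂ, ∃ c ∈ 𝒞, ∀ᶠ p in cofinite, σ (a p) = c p := by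
    intro σ
    obtain ⟨π', hconj, hπ'⟩ := hA n K hcpt π hπ σ
    obtain ⟨c, hc, hc'⟩ := h𝒞π π' hπ'
    refine ⟨c, hc, ?_⟩
    have hplaces : ∀ᶠ v : HeightOneSpectrum (𝓞 K) in cofinite, ∀ i : Fin (n + 1),
        σ (a (v, i)) = c (v, i) := by
      change ∀ᶠ v : HeightOneSpectrum (𝓞 K) in Filter.cofinite, _ at hconj
      filter_upwards [hconj, hc'] with v hv hcv i
      obtain ⟨α, α', hα, hα', ht⟩ := hv
      rw [ha hα, ← hcv α' hα' i]
      exact (ht i (Nat.lt_succ_iff.1 i.2)).symm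
    have hfin := Filter.eventually_cofinite.1 hplaces
    refine Filter.eventually_cofinite.2 ((hfin.prod (Set.finite_univ (α := Fin (n + 1)))).subset ?_)
    rintro ⟨v, i⟩ hp
    refine ⟨?_, Set.mem_univ _⟩
    intro hall
    exact hp (hall i)
  -- UNIF
  obtain ⟨E, hE, hmem⟩ := uniform_of_countable_autOrbit hS3 a 𝒞 h𝒞 horbit
  refine ⟨E, hE, ?_⟩
  have hbad : {p : HeightOneSpectrum (𝓞 K) × Fin (n + 1) | ¬ a p ∈ E}.Finite :=
    Filter.eventually_cofinite.1 hmem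
  refine Filter.eventually_cofinite.2 ((hbad.image Prod.fst).subset fun v hv => ?_)
  by_contra hnot
  apply hv
  intro α hα i hi
  have hp : a (v, ⟨i, Nat.lt_succ_of_le hi⟩) ∈ E := by
    by_contra hne
    exact hnot ⟨(v, ⟨i, Nat.lt_succ_of_le hi⟩), hne, rfl⟩
  rw [ha hα ⟨i, Nat.lt_succ_of_le hi⟩] at hp
  exact hp

/-- **(S4) + clause (ii) ⟹ the Hecke field**, (S3) being discharged by the landed `stub_S3`:
from the countability of the cofinite germs of unramified Hecke eigensystems of regular algebraic
cuspidal representations (statement (S4) of the line, proved in `…S4.lean`) and the existence of regular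
algebraic cuspidal `Aut(ℂ)`-conjugates at almost all places, the named fact
`Clozel1990_heckeEigenvalueField` (definitionally the crux). [folklore] -/
theorem clozel1990_heckeEigenvalueField_of_S4_autConjugates
    (hS4 : ∀ (n : ℕ) (K : Type) [Field K] [NumberField K]
      (hcpt : isCompact_glFiniteIntegralLevel n K),
      ∃ 𝒞 : Set (HeightOneSpectrum (𝓞 K) × Fin (n + 1) → ℂ), 𝒞.Countable ∧
        ∀ π : CuspidalAutomorphicRepData n K hcpt, π.1.IsRegularAlgebraic →
          ∃ c ∈ 𝒞, ∀ᶠ v in cofinite, ∀ α : Multiset ℂ, π.1.HasSatakeParamAt v α →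
            ∀ i : Fin (n + 1), heckeEigenvalueOf n v α i = c (v, i))
    (hA : ∀ (n : ℕ) (K : Type) [Field K] [NumberField K]
      (hcpt : isCompact_glFiniteIntegralLevel n K)
      (π : CuspidalAutomorphicRepData n K hcpt), π.1.IsRegularAlgebraic → ∀ σ : ℂ ≃ₐ[ℚ] ℂ,
        ∃ π' : CuspidalAutomorphicRepData n K hcpt, IsAutConjugate σ π.1 π'.1 ∧ π'.1.IsRegularAlgebraic) :
    Clozel1990_heckeEigenvalueField :=
  heckeEigenvalueField_of_S3_S4_conj stub_S3 hS4 hA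

end Automorphic

end Summit.Langlands.Langlands.Theorems.HeckeEigenvalueField.Baire

end
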